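import Summits.NavierStokesRegularity.OSWSelfSimilar.SheetRGeneratorEvenDense
import Summits.NavierStokesRegularity.OSWSelfSimilar.SheetREvansEven
import Summits.NavierStokesRegularity.OSWSelfSimilar.SheetRLinearisedFlow
import HarnessLib

/-!
# SHEET-ℝ frame, Z3-SR-SPEC (P9)⁺ on the EVEN ZERO-MASS class: `T⁺ = generatorEven = −A⁺_F|E⁺₀` GENERATES a C₀-semigroup with `‖S⁺(τ)‖ ≤ e^{−mτ}`,
# and the FULL even linearisation `T⁺ + θℓ(·)f` (bounded rank-one feedback) generates one with `‖·‖ ≤ e^{(b−m)τ}`; eigenvectors evolve as `e^{στ}`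

HONEST FRAMING (cell ns-blowup GROUP B / zone Z3, case Z3-SR-SPEC EVEN half, P-list item (P9)⁺ «C₀-semigroup generation on `E⁺₀`» — the even twin of
selfsim g13's `SheetRLinearisedSemigroup` / `SheetRLinearisedFlow`; 1-D MODEL certificate frame (viscous gCLM/OSW sheet on the line); not Euler/NS; «violates:
none — MODEL»).  Nothing here asserts that a profile or an eigenvalue exists; the (S1⁺) Gårding datum `h : GardingDataKE …` (interval arithmetic of record) is
the ONLY hypothesis; `K : EspE L hL →L[ℝ] W L`, `ℓ : WcevenZ hL →L[ℂ] ℂ`, `f : WcevenZ hL`, `θ : ℂ` are arbitrary.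
selfsim g14 built the even resolvent `R⁺_K(σ) = resolventEven hL K h σ` on `WcevenZ hL ⊂ L²_w(ℂ)` — an injective pseudo-resolvent on `{Re σ > −m}` with the
SHARP PIVOT BOUND `‖R⁺_K(σ)G‖ ≤ ‖G‖/(m + Re σ)` — and Kato's closed operator `T⁺ = generatorEven hL K h σ₀ hσ₀` (ONE operator for every base point:
`SheetRGeneratorBasePoint.generatorEven_eq`); `SheetRGeneratorEvenDense.dense_domain_generatorEven` gives the density of `D(T⁺)`.  The generic
Hille–Yosida library (`Literature/Analysis/UnboundedOperators/HilleYosida{Approximants,Semigroup,Generator,Rescaled,Perturbation}`) then yields: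
* `exists_c0SemigroupE` — a C₀-semigroup `S⁺` on `WcevenZ hL` with **`‖S⁺(τ)‖ ≤ e^{−mτ}`**, Laplace transform `R⁺_K`, generator `= T⁺`;
* `hasDerivWithinAt_orbitE`, `app_eq_exp_smul_of_eigenE` — orbits on `D(T⁺)` solve `δ' = T⁺δ`; eigenvectors of `T⁺` evolve as `e^{μτ}`;
* `exists_c0Semigroup_fullE` — the FULL even linearisation `T⁺ + θℓ(·)f` (`‖(θ•ℓ).smulRight f‖ ≤ b`) generates a C₀-semigroup with `‖·‖ ≤ e^{(b−m)τ}`, Laplace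
  transform the perturbed resolvent `R⁺_K(σ)(1 − F′R⁺_K(σ))⁻¹`, generator domain `= D(T⁺)`, action `T⁺u + θℓ(u)f` (Engel–Nagel III Thm 1.3, `M = 1`);
* `app_eq_exp_smul_of_eigen_fullE` — a vector with `u ∈ D(T⁺)`, `T⁺u = σu − θℓ(u)f` (the eigen-equation of `SheetRSpectrumEvenAssembly.eigen_set_eq_singleton`,
  e.g. the translation mode at `σ = 1/2`) evolves as `S(τ)u = e^{στ}u`.
No definition, no named fact.  WHAT THIS IS NOT: not NS; not (P10)⁺ (no decay-modulo-translation word is claimed); no number of record moves.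
-/

noncomputable section

namespace Summit.NavierStokesRegularity.OSWSelfSimilar
namespace SheetRLinearisedSemigroupEven

open _root_.MeasureTheory _root_.Set _root_.Filter SheetREnergySpace SheetRComplexPivot SheetREvenEnergySpace SheetREvenForms SheetREvenClass
  SheetRResolventEvenClass SheetRGeneratorEvenWeak SheetREvansEven SheetRGeneratorEvenDense SheetRLinearisedSemigroup SheetRLinearisedFlow
  Literature.Analysis.OperatorTheory Literature.Analysis.UnboundedOperators Literature.Analysis.UnboundedOperators.HilleYosida
open scoped Topology NNReal

variable {L D₀ D₁ V₀ c m : ℝ} {d V : ℝ → ℝ}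

/-! ### §1 The Hille–Yosida hypotheses for `resolventEven` -/

/-- **The Hille–Yosida bound for the even sheet resolvent**: `‖R⁺_K(λ)‖ ≤ 1/(λ + m)` for real `λ > −m` (operator norm on the even zero-mass class; from the
sharp pivot bound `norm_resolventEven_le_inv`). [folklore] -/
theorem norm_resolventEven_le (hL : 0 < L) (K : EspE L hL →L[ℝ] W L) (h : GardingDataKE L hL d V K D₀ D₁ V₀ c m) {l : ℝ} (hl : -m < l) :
    ‖resolventEven hL K h l‖ ≤ (l + m)⁻¹ := by
  have hlm : 0 < l + m := by linarith
  refine ContinuousLinearMap.opNorm_le_bound _ (inv_nonneg.2 hlm.le) fun G => ?_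
  have hb := norm_resolventEven_le_inv hL K h (σ := (l : ℂ)) (by simpa using hl) G
  rw [Complex.ofReal_re] at hb
  calc ‖resolventEven hL K h l G‖ ≤ ‖G‖ / (m + l) := hb
    _ = (l + m)⁻¹ * ‖G‖ := by rw [div_eq_inv_mul, add_comm]

/-- Operator-norm form of the pivot bound: `‖R⁺_K(σ)‖ ≤ 1/(m + Re σ)` on the even zero-mass class. [folklore] -/
theorem opNorm_resolventEven_le (hL : 0 < L) (K : EspE L hL →L[ℝ] W L) (h : GardingDataKE L hL d V K D₀ D₁ V₀ c m) {σ : ℂ} (hσ : -m < σ.re) :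
    ‖resolventEven hL K h σ‖ ≤ (m + σ.re)⁻¹ := by
  have hpos : 0 < m + σ.re := by linarith
  refine ContinuousLinearMap.opNorm_le_bound _ (inv_nonneg.2 hpos.le) fun G => ?_
  rw [inv_mul_eq_div]
  exact norm_resolventEven_le_inv hL K h hσ G

/-- The range of `R⁺_K(σ₀)` is dense in the even zero-mass class (= density of `D(T⁺)`). [folklore] -/
theorem dense_range_resolventEven (hL : 0 < L) (K : EspE L hL →L[ℝ] W L) (h : GardingDataKE L hL d V K D₀ D₁ V₀ c m) {σ₀ : ℂ} (hσ₀ : -m < σ₀.re) :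
    Dense (Set.range (resolventEven hL K h σ₀)) := by
  have hd := dense_domain_generatorEven hL K h hσ₀
  rw [generatorEven_domain] at hd
  simpa only [LinearMap.coe_range, ContinuousLinearMap.coe_coe] using hd

/-! ### §2 (P9)⁺: the semigroup generated by `T⁺ = generatorEven` -/

/-- **Z3-SR-SPEC (P9)⁺ — C₀-SEMIGROUP GENERATION FOR THE EVEN SHEET LINEARISATION (modulo the (S1⁺) datum only).**  For a Gårding datum `h` of the perturbed
form on zero-mass even tests and `σ₀` with `Re σ₀ > −m`: there is a C₀-semigroup `S⁺` on `WcevenZ hL` with `‖S⁺(τ)‖ ≤ e^{−mτ}` for all `τ ≥ 0`, with Laplace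
transform `∫₀^∞ e^{−στ}S⁺(τ)G dτ = R⁺_K(σ)G` for every `Re σ > −m`, and with generator EQUAL to `T⁺ = generatorEven hL K h σ₀ _`.  Hille–Yosida (Engel–Nagel II
Cor. 3.6) applied to the injective pseudo-resolvent `resolventEven` with its pivot bound and the density of `D(T⁺)` (`dense_domain_generatorEven`).  1-D MODEL;
conditional on the interval datum (S1⁺) through `h` ONLY; NOT Navier–Stokes. [cite: EngelNagel2000, Ch. II Cor. 3.6] -/
theorem exists_c0SemigroupE (hL : 0 < L) (K : EspE L hL →L[ℝ] W L) (h : GardingDataKE L hL d V K D₀ D₁ V₀ c m) {σ₀ : ℂ} (hσ₀ : -m < σ₀.re) :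
    ∃ S : C0Semigroup ℂ (WcevenZ hL), (∀ τ : ℝ≥0, ‖S.app τ‖ ≤ Real.exp (-m * τ)) ∧
      (∀ σ : ℂ, -m < σ.re → ∀ G : WcevenZ hL, S.laplaceResolventFun σ G = resolventEven hL K h σ G) ∧
      S.generator = generatorEven hL K h σ₀ hσ₀ := by
  haveI : CompleteSpace (WcevenZ hL) := completeSpace_WcevenZ hL
  obtain ⟨S, hS, hlap, hgen⟩ := HilleYosida.exists_c0Semigroup_of_resolvent_bound (isPseudoResolvent_resolventEven hL K h)
    (fun l hl => ofReal_mem_halfPlane hl) (fun l hl => norm_resolventEven_le hL K h hl) hσ₀ hσ₀ (dense_range_resolventEven hL K h hσ₀)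
  exact ⟨S, hS, fun σ hσ G => hlap σ hσ hσ G, hgen⟩

/-! ### §3 What the semigroup does: orbits on the domain, eigenvectors -/

/-- **The linearised even flow on the domain**: for any C₀-semigroup `S` on the even zero-mass class whose generator is `T⁺` and `u ∈ D(T⁺)`, the orbit
`τ ↦ S(τ)u` is right-differentiable at every `τ ≥ 0` with derivative `S(τ)(T⁺u)` — `δ' = T⁺δ = −A⁺_F δ` is solved by `δ(τ) = S(τ)δ₀`. [cite: EngelNagel2000, Ch. II Lemma 1.3] -/
theorem hasDerivWithinAt_orbitE (hL : 0 < L) (K : EspE L hL →L[ℝ] W L) (h : GardingDataKE L hL d V K D₀ D₁ V₀ c m) {σ₀ : ℂ} (hσ₀ : -m < σ₀.re)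
    (S : C0Semigroup ℂ (WcevenZ hL)) (hgen : S.generator = generatorEven hL K h σ₀ hσ₀)
    {u : WcevenZ hL} (hu : u ∈ (generatorEven hL K h σ₀ hσ₀).domain) (τ : ℝ≥0) :
    HasDerivWithinAt (fun s : ℝ => S.app s.toNNReal u) (S.app τ (generatorEven hL K h σ₀ hσ₀ ⟨u, hu⟩)) (Set.Ici (τ : ℝ)) τ := by
  have hu' : u ∈ S.generator.domain := by rw [hgen]; exact hu
  have hd := S.hasDerivWithinAt_Ici_app_of_mem ⟨u, hu'⟩ τ
  have heq : S.generator ⟨u, hu'⟩ = generatorEven hL K h σ₀ hσ₀ ⟨u, hu⟩ := by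
    have hgraph : ((u : WcevenZ hL), S.generator ⟨u, hu'⟩) ∈ (generatorEven hL K h σ₀ hσ₀).graph := by
      rw [← hgen]; exact S.generator.mem_graph ⟨u, hu'⟩
    exact ((generatorEven hL K h σ₀ hσ₀).mem_graph_snd_inj (LinearPMap.mem_graph _ ⟨u, hu⟩) hgraph rfl).symm
  rw [heq] at hd
  exact hd

/-- **Eigenvectors of `T⁺` evolve exponentially**: if `T⁺u = μu` (`u ∈ D(T⁺)`) then `S(τ)u = e^{μτ}u` for every C₀-semigroup `S` on the even zero-mass class with
generator `T⁺`. [cite: EngelNagel2000, Ch. II Lemma 1.3] -/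
theorem app_eq_exp_smul_of_eigenE (hL : 0 < L) (K : EspE L hL →L[ℝ] W L) (h : GardingDataKE L hL d V K D₀ D₁ V₀ c m) {σ₀ : ℂ}
    (hσ₀ : -m < σ₀.re) (S : C0Semigroup ℂ (WcevenZ hL)) (hgen : S.generator = generatorEven hL K h σ₀ hσ₀)
    {u : WcevenZ hL} (hu : u ∈ (generatorEven hL K h σ₀ hσ₀).domain) {μ : ℂ} (heig : generatorEven hL K h σ₀ hσ₀ ⟨u, hu⟩ = μ • u) (τ : ℝ≥0) :
    S.app τ u = Complex.exp (μ * τ) • u := by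
  haveI : CompleteSpace (WcevenZ hL) := completeSpace_WcevenZ hL
  have hu' : u ∈ S.generator.domain := by rw [hgen]; exact hu
  have heq : S.generator ⟨u, hu'⟩ = μ • u := by
    have hgraph : ((u : WcevenZ hL), S.generator ⟨u, hu'⟩) ∈ (generatorEven hL K h σ₀ hσ₀).graph := by
      rw [← hgen]; exact S.generator.mem_graph ⟨u, hu'⟩
    rw [← heig]
    exact ((generatorEven hL K h σ₀ hσ₀).mem_graph_snd_inj (LinearPMap.mem_graph _ ⟨u, hu⟩) hgraph rfl).symm
  exact C0Semigroup.app_eq_exp_smul_of_generator_eq S ⟨u, hu'⟩ heq τ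

/-! ### §4 The rank-one feedback on the even zero-mass class and the FULL even linearisation -/

/-- The rank-one operator `u ↦ θℓ(u)f` on the even zero-mass class acts as written. [folklore] -/
theorem rankOneE_apply {hL : 0 < L} (ℓ : WcevenZ hL →L[ℂ] ℂ) (f : WcevenZ hL) (θ : ℂ) (u : WcevenZ hL) :
    ((θ • ℓ).smulRight f) u = (θ * ℓ u) • f := by
  rw [ContinuousLinearMap.smulRight_apply, smul_apply, smul_eq_mul]

/-- **Smallness**: for a bounded `F′` on the even zero-mass class with `‖F′‖ ≤ b` and `Re σ > b − m`, `‖F′R⁺_K(σ)‖ < 1`. [folklore] -/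
theorem norm_mul_resolventEven_lt_one (hL : 0 < L) (K : EspE L hL →L[ℝ] W L) (h : GardingDataKE L hL d V K D₀ D₁ V₀ c m)
    {F' : WcevenZ hL →L[ℂ] WcevenZ hL} {b : ℝ} (hF : ‖F'‖ ≤ b) {σ : ℂ} (hσ : b - m < σ.re) : ‖F' * resolventEven hL K h σ‖ < 1 := by
  have hb : 0 ≤ b := (norm_nonneg F').trans hF
  have hσ' : -m < σ.re := by linarith
  have hpos : 0 < m + σ.re := by linarith
  calc ‖F' * resolventEven hL K h σ‖ ≤ ‖F'‖ * ‖resolventEven hL K h σ‖ := ContinuousLinearMap.opNorm_comp_le F' _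
    _ ≤ b * (m + σ.re)⁻¹ := mul_le_mul hF (opNorm_resolventEven_le hL K h hσ') (norm_nonneg (resolventEven hL K h σ)) hb
    _ < 1 := by rw [← div_eq_mul_inv, div_lt_one hpos]; linarith

/-- **Z3-SR-SPEC (P9)⁺, FULL EVEN LINEARISATION — `−DG⁺(Ω*)|E⁺₀ = T⁺ + θℓ(·)f` GENERATES A C₀-SEMIGROUP (modulo the (S1⁺) datum only).**  For a Gårding datum
`h` (the (S1⁺) sentence), rank-one data `(ℓ, f, θ)` on the even zero-mass class with `‖(θ•ℓ).smulRight f‖ ≤ b`, and a base point `σ₀` with `Re σ₀ > b − m`: there is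
a C₀-semigroup `S` on `WcevenZ hL` with `‖S(τ)‖ ≤ e^{(b − m)τ}`, whose Laplace transform on `{Re σ > b − m}` is the perturbed resolvent `R⁺_K(σ)(1 − F′R⁺_K(σ))⁻¹`
(`F′ = θℓ(·)f`), whose generator `B` has EXACTLY the domain of `T⁺ = generatorEven hL K h σ₀ _`, and which acts there as `Bu = T⁺u + θℓ(u)f`.  Engel–Nagel III.1.3
(`M = 1`) for the injective pseudo-resolvent `resolventEven`; density of `D(T⁺)` by `dense_domain_generatorEven`.  1-D MODEL, conditional on (S1⁺) through `h`;
NOT Navier–Stokes. [cite: EngelNagel2000, Ch. III Thm. 1.3] -/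
theorem exists_c0Semigroup_fullE (hL : 0 < L) (K : EspE L hL →L[ℝ] W L) (h : GardingDataKE L hL d V K D₀ D₁ V₀ c m)
    (ℓ : WcevenZ hL →L[ℂ] ℂ) (f : WcevenZ hL) (θ : ℂ) {b : ℝ} (hF : ‖(θ • ℓ).smulRight f‖ ≤ b) {σ₀ : ℂ} (hσ₀ : b - m < σ₀.re) :
    ∃ hσ₀' : -m < σ₀.re, ∃ S : C0Semigroup ℂ (WcevenZ hL),
      (∀ τ : ℝ≥0, ‖S.app τ‖ ≤ Real.exp ((b - m) * τ)) ∧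
      (∀ σ : ℂ, b - m < σ.re → ∀ G : WcevenZ hL,
        S.laplaceResolventFun σ G =
          @perturb (WcevenZ hL) _ _ (completeSpace_WcevenZ hL) (resolventEven hL K h) ((θ • ℓ).smulRight f) σ G) ∧
      ((S.generator.domain : Set (WcevenZ hL)) = (generatorEven hL K h σ₀ hσ₀').domain) ∧
      (∀ (u : WcevenZ hL) (hu : u ∈ (generatorEven hL K h σ₀ hσ₀').domain), ∃ hu' : u ∈ S.generator.domain,
        S.generator ⟨u, hu'⟩ = generatorEven hL K h σ₀ hσ₀' ⟨u, hu⟩ + (θ * ℓ u) • f) := by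
  haveI : CompleteSpace (WcevenZ hL) := completeSpace_WcevenZ hL
  have hb : 0 ≤ b := (norm_nonneg ((θ • ℓ).smulRight f)).trans hF
  have hσ₀' : -m < σ₀.re := by linarith
  refine ⟨hσ₀', ?_⟩
  set F' : WcevenZ hL →L[ℂ] WcevenZ hL := (θ • ℓ).smulRight f with hF'
  have hsmall : ‖F' * resolventEven hL K h σ₀‖ < 1 := norm_mul_resolventEven_lt_one hL K h hF hσ₀
  obtain ⟨hinj, S, hS, hlap, hgen⟩ := HilleYosida.exists_c0Semigroup_perturb (K := F') (isPseudoResolvent_resolventEven hL K h)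
    (m := m) (b := b) (fun l hl => ofReal_mem_halfPlane hl) (fun l hl => norm_resolventEven_le hL K h hl) hF
    (z₀ := σ₀) hσ₀' (by linarith) hsmall (dense_range_resolventEven hL K h hσ₀')
  refine ⟨S, fun τ => ?_, fun σ hσ G => hlap σ (by show -m < σ.re; linarith) (by linarith)
    (norm_mul_resolventEven_lt_one hL K h hF hσ) G, ?_, fun u hu => ?_⟩
  · have := hS τ; rwa [neg_sub] at this
  · rw [hgen]
    exact operatorOfResolvent_perturb_domain hsmall (injective_resolventEven hL K h hσ₀')
  · obtain ⟨hu', happ⟩ := operatorOfResolvent_perturb_apply hsmall (injective_resolventEven hL K h hσ₀') (u := u) hu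
    have hu'' : u ∈ S.generator.domain := by rw [hgen]; exact hu'
    refine ⟨hu'', ?_⟩
    have hgraph : ((u : WcevenZ hL), S.generator ⟨u, hu''⟩) ∈
        (operatorOfResolvent (perturb (resolventEven hL K h) F') σ₀ hinj).graph := by
      rw [← hgen]; exact S.generator.mem_graph ⟨u, hu''⟩
    have heq := ((operatorOfResolvent (perturb (resolventEven hL K h) F') σ₀ hinj).mem_graph_snd_inj
      (LinearPMap.mem_graph _ ⟨u, hu'⟩) hgraph rfl).symm
    rw [heq, happ, rankOneE_apply]
    rfl

/-! ### §5 Eigen-equations of the full even linearisation evolve exponentially -/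

/-- **`S(τ)u = e^{στ}u` for a solution of the even eigen-equation.**  Let `S` be any C₀-semigroup on the even zero-mass class whose generator has the domain of
`T⁺` and acts as `T⁺u + θℓ(u)f` there (e.g. the semigroup of `exists_c0Semigroup_fullE`).  If `u ∈ D(T⁺)` satisfies `T⁺u = σu − θℓ(u)f` — the eigen-equation of
`SheetRSpectrumEvenAssembly.eigen_set_eq_singleton` (whose only solution with `Re σ ≥ −3/100` is the translation mode at `σ = 1/2`, modulo the named data) — then
`S(τ)u = e^{στ}u` for all `τ ≥ 0`: the translation mode of the MODEL linearisation grows exactly like `e^{τ/2}`. [cite: EngelNagel2000, Ch. II Lemma 1.3] -/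
theorem app_eq_exp_smul_of_eigen_fullE (hL : 0 < L) (K : EspE L hL →L[ℝ] W L) (h : GardingDataKE L hL d V K D₀ D₁ V₀ c m) {σ₀ : ℂ}
    (hσ₀ : -m < σ₀.re) (ℓ : WcevenZ hL →L[ℂ] ℂ) (f : WcevenZ hL) (θ : ℂ) (S : C0Semigroup ℂ (WcevenZ hL))
    (hgen : ∀ (u : WcevenZ hL) (hu : u ∈ (generatorEven hL K h σ₀ hσ₀).domain), ∃ hu' : u ∈ S.generator.domain,
      S.generator ⟨u, hu'⟩ = generatorEven hL K h σ₀ hσ₀ ⟨u, hu⟩ + (θ * ℓ u) • f)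
    {σ : ℂ} {u : WcevenZ hL} (huT : u ∈ (generatorEven hL K h σ₀ hσ₀).domain)
    (hT : generatorEven hL K h σ₀ hσ₀ ⟨u, huT⟩ = σ • u - (θ * ℓ u) • f) (τ : ℝ≥0) :
    S.app τ u = Complex.exp (σ * τ) • u := by
  haveI : CompleteSpace (WcevenZ hL) := completeSpace_WcevenZ hL
  obtain ⟨hu', hB⟩ := hgen u huT
  have heig : S.generator ⟨u, hu'⟩ = σ • u := by rw [hB, hT]; abel
  exact C0Semigroup.app_eq_exp_smul_of_generator_eq S ⟨u, hu'⟩ heig τ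

end SheetRLinearisedSemigroupEven
end Summit.NavierStokesRegularity.OSWSelfSimilar

end
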